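import Literature.AlgebraicGeometry.HodgeTheory.ComplexOrientationFamily
import Literature.AlgebraicTopology.SingularHomology.PoincareDualityProofs
import HarnessLib

/-!
# Poincaré duality on `X(ℂ)` for a smooth projective complex variety: `D_μ : Hᵖ(X(ℂ); R) → H_q(X(ℂ); R)` is bijective

Family `hodge`, layer `Literature/AlgebraicGeometry/HodgeTheory`; theorems only (no definition, no named fact). Written by the prover seat
`hodge-nonav-prover-Ax` (g18). Hatcher, *Algebraic Topology* (2002), §3.3 Thm. 3.30, PROVED in the tree for closed `R`-oriented topological
manifolds (`Literature.AlgebraicTopology.SingularHomology.poincare_duality`); here with the manifold structure of `X(ℂ)` supplied from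
`IsSmoothProjective` (compact Hausdorff topological `2n`-manifold: `hX.chartedSpace`, `compactSpace_of_isSmoothProjective`,
`t2Space_of_isSmoothProjective`) — the instance-free form consumed by
`Summit…Theorems.Q8MonodromyBireflectionAssembly.monodromyBireflection_of_twoBallDatum` (hypothesis `hPD`, crux K1Q stub S5,
`Summits/HodgeConjecture/HodgeConjecture/Theses/Q8SymplecticPowers.lean`); the abelian-variety case is the tree's
`AbelianVarietyPoincareDualityGysinDegree.bijective_poincareDualityMap'`.

* **`bijective_poincareDualityMap_of_isSmoothProjective`** (any orientation `μ`, any `R`), **`bijective_poincareDualityMap_complexOrientationRat`**.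

## References

* [HatcherAT2002] A. Hatcher, Algebraic Topology, CUP 2002, §3.3 Thm. 3.30.
-/

noncomputable section

open Literature.AlgebraicTopology.SingularHomology Literature.AlgebraicGeometry.Motives

namespace Literature.AlgebraicGeometry.HodgeTheory

variable {n : ℕ} {X : Motives.SchemeOver ℂ}

/-- **Poincaré duality on `X(ℂ)`**, `X` smooth projective of dimension `n`: for every commutative ring `R`, every `R`-orientation `μ` of
`X(ℂ)` and all `p + q = 2n`, `a ↦ a ⌢ [X(ℂ)]_μ : Hᵖ(X(ℂ); R) → H_q(X(ℂ); R)` is bijective. [cite: HatcherAT2002, §3.3 Thm. 3.30] -/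
theorem bijective_poincareDualityMap_of_isSmoothProjective {R : Type} [CommRing R] (hX : Motives.IsSmoothProjective n X)
    (μ : HomologicalOrientation R (Motives.ComplexPoints X) (2 * n)) {p q : ℕ} (h : p + q = 2 * n) :
    Function.Bijective (poincareDualityMap μ h) := by
  letI := hX.chartedSpace
  haveI := Motives.ComplexPoints.compactSpace_of_isSmoothProjective hX
  haveI := Motives.ComplexPoints.t2Space_of_isSmoothProjective hX
  exact poincare_duality μ h

/-- **Poincaré duality for the rational complex orientation** of a smooth projective `n`-fold. [cite: HatcherAT2002, §3.3 Thm. 3.30] -/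
theorem bijective_poincareDualityMap_complexOrientationRat (hX : Motives.IsSmoothProjective n X) {p q : ℕ} (h : p + q = 2 * n) :
    Function.Bijective (poincareDualityMap (complexOrientationRat hX) h) :=
  bijective_poincareDualityMap_of_isSmoothProjective hX _ h

/-- The surface case in the literal currency of the K1Q assembly (`n = 4`, `2 + 2 = 4`). [cite: HatcherAT2002, §3.3 Thm. 3.30] -/
theorem bijective_poincareDualityMap_complexOrientationRat_two (hX : Motives.IsSmoothProjective 2 X) :
    Function.Bijective (poincareDualityMap (n := 4) (complexOrientationRat hX) (show 2 + 2 = 4 by norm_num)) :=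
  bijective_poincareDualityMap_complexOrientationRat hX (p := 2) (q := 2) (by norm_num)

end Literature.AlgebraicGeometry.HodgeTheory

end
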